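import Literature.NumberTheory.LFunctions.IdealMoebiusCoprime
import HarnessLib

/-!
# Möbius sums over the ideals coprime to `𝔠`: the numerator bounded on `Re s = σ_h ∈ (0, 1)`

Companion of `IdealMoebiusCoprime.lean` (proofs only; no definitions, no named facts). There the
evaluation of Heath-Brown's sum `Σ = ∑_{N(B) ≤ x, (B,𝔠)=1} μ(B)N(B)^{-1}log(x/N(B))`
(D. R. Heath-Brown, *Primes represented by `x³ + 2y³`*, Acta Math. 186 (2001), p. 51) is obtained from
`logRieszMean_LSeries_div_dedekindZeta_bound` with the numerator `H(s) = ∑ h_𝔠(n) n^{-s}`,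
`h_𝔠(n) = #{D : N(D) = n, P ∣ D ⇒ P ∣ 𝔠}`, bounded on the line `σ_h = 1/2`, which produces the factor
`B(𝔠) = ∏_{p ∣ N(𝔠)} ∑_e c_K(p^e) p^{-e/2}`. Heath-Brown (loc. cit.) records instead
"`∏_{P ∣ C}(1 + N(P)^{-σ-1}) ≪ exp{c(log N(C))^{1/4}}`", i.e. he bounds the numerator on a line
`σ_h = 3/4`, where the factor is `exp(O(∑_{p ∣ N(𝔠)} p^{-3/4}))`, genuinely smaller than
`exp(−c√(log x))⁻¹` uniformly in `N(𝔠) ≤ x`. This file provides the `σ_h`-version for every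
`0 < σ_h < 1`:

* `summable_localFactor_rpow`, `tsum_norm_term_supportedCount_rpow_le` — the local factors
  `∑_e c_K(p^e)(p^e)^{-σ}` (`σ > 0`) and `∑_n h_𝔠(n) n^{-σ} ≤ ∏_{p ∣ N(𝔠)} ∑_e c_K(p^e)(p^e)^{-σ}`;
* `exists_localFactor_rpow_le` — `∑_e c_K(p^e)(p^e)^{-σ} ≤ 1 + M_{K,σ} p^{-σ}` for all primes `p`;
* **`coprimeMoebius_logRieszMean_bound_rpow`** — for `0 < σ < 1` there are `c, C > 0`, `M ≥ 0` with
  `|∑_{n ≤ x} a_𝔠(n) n^{-1} log(x/n) − ρ_K^{-1}∏_{P ∣ 𝔠}(1 − N(P)^{-1})^{-1}|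
     ≤ C · exp(M ∑_{p ∣ N(𝔠)} p^{-σ}) · exp(−c√(log x))` for every nonzero ideal `𝔠` and `x ≥ 1`.

## References

* D. R. Heath-Brown, *Primes represented by `x³ + 2y³`*, Acta Math. 186 (2001), 1–84: §8, p. 51.
  [cite: HeathBrownActa2001, §8 p. 51]
* H. L. Montgomery, R. C. Vaughan, *Multiplicative Number Theory I*, CUP 2007, §6.2.
  [cite: MontgomeryVaughan2007, §6.2]

## Mathlib / tree search

Tree: `logRieszMean_LSeries_div_dedekindZeta_bound` (any `σ_h < 1`), `summable_localFactor`,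
`tsum_norm_term_supportedCount_le` (the case `σ = 1/2`, whose proofs are followed verbatim),
`card_supported_le`, `absNorm_mem_factoredNumbers`, `LSeries_coprimeMoebiusSum_mul_dedekindZeta`,
`LSeries_supportedCount_one`, `idealNormCount_prime_pow_le`, `idealNormCount_mul_of_coprime`.
Mathlib: `EulerProduct.summable_and_hasSum_factoredNumbers_prod_filter_prime_tsum`,
`summable_pow_mul_geometric_of_norm_lt_one`, `Real.add_one_le_exp`, `Real.exp_sum`.
-/

noncomputable section

open UniqueFactorizationMonoid Finset LSeries
open scoped NumberField LSeries.notation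

namespace Literature.NumberTheory.LFunctions.NumberField

variable {K : Type*} [Field K] [NumberField K]

/-- The local factors `∑_e c_K(p^e) (p^e)^{-σ}` converge for `σ > 0` (`c_K(p^e) ≤ (e+1)^{[K:ℚ]}`,
`p^{-σ} < 1`). [folklore] -/
theorem summable_localFactor_rpow {σ : ℝ} (hσ : 0 < σ) {p : ℕ} (hp : p.Prime) :
    Summable fun e : ℕ ↦ (idealNormCount K (p ^ e) : ℝ) * ((p : ℝ) ^ e) ^ (-σ) := by
  set d : ℕ := Module.finrank ℚ K
  set r : ℝ := (p : ℝ) ^ (-σ) with hr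
  have hp2 : (2 : ℝ) ≤ p := by exact_mod_cast hp.two_le
  have hr0 : 0 < r := Real.rpow_pos_of_pos (by linarith) _
  have hr1 : r < 1 := Real.rpow_lt_one_of_one_lt_of_neg (by linarith) (by linarith)
  have hg : Summable fun n : ℕ ↦ ((n : ℝ) ^ d * r ^ n) :=
    summable_pow_mul_geometric_of_norm_lt_one d (by rwa [Real.norm_of_nonneg hr0.le])
  have hg1 : Summable fun n : ℕ ↦ r⁻¹ * (((n + 1 : ℕ) : ℝ) ^ d * r ^ (n + 1)) :=
    ((summable_nat_add_iff 1).2 hg).mul_left r⁻¹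
  refine Summable.of_nonneg_of_le (fun e ↦ by positivity) (fun e ↦ ?_) hg1
  have hce := idealNormCount_prime_pow_le K p e hp
  have hpow : ((p : ℝ) ^ e) ^ (-σ) = r ^ e := by
    rw [hr, ← Real.rpow_natCast, ← Real.rpow_mul (by linarith), mul_comm, Real.rpow_mul (by linarith),
      Real.rpow_natCast]
  rw [hpow]
  calc (idealNormCount K (p ^ e) : ℝ) * r ^ e ≤ ((e : ℝ) + 1) ^ d * r ^ e := by gcongr
    _ = r⁻¹ * (((e + 1 : ℕ) : ℝ) ^ d * r ^ (e + 1)) := by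
        push_cast
        field_simp
        ring

/-- **`∑_e c_K(p^e)(p^e)^{-σ} ≤ 1 + M p^{-σ}`** for all primes `p`, with
`M = M_{K,σ} = ∑_e (e+2)^{[K:ℚ]} 2^{-eσ}` (`c_K(1) = 1`, `c_K(p^{e+1}) ≤ (e+2)^{[K:ℚ]}`, `p ≥ 2`). [folklore] -/
theorem exists_localFactor_rpow_le {σ : ℝ} (hσ : 0 < σ) :
    ∃ M : ℝ, 0 ≤ M ∧ ∀ p : ℕ, p.Prime →
      ∑' e : ℕ, (idealNormCount K (p ^ e) : ℝ) * ((p : ℝ) ^ e) ^ (-σ) ≤ 1 + M * (p : ℝ) ^ (-σ) := by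
  set d : ℕ := Module.finrank ℚ K
  set r₂ : ℝ := (2 : ℝ) ^ (-σ) with hr₂
  have hr₂0 : 0 < r₂ := Real.rpow_pos_of_pos two_pos _
  have hr₂1 : r₂ < 1 := Real.rpow_lt_one_of_one_lt_of_neg one_lt_two (by linarith)
  have hg : Summable fun n : ℕ ↦ ((n : ℝ) ^ d * r₂ ^ n) :=
    summable_pow_mul_geometric_of_norm_lt_one d (by rwa [Real.norm_of_nonneg hr₂0.le])
  have hM : Summable fun e : ℕ ↦ ((e : ℝ) + 2) ^ d * r₂ ^ e := by
    have hg2 : Summable fun n : ℕ ↦ (r₂ ^ 2)⁻¹ * (((n + 2 : ℕ) : ℝ) ^ d * r₂ ^ (n + 2)) :=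
      ((summable_nat_add_iff 2).2 hg).mul_left (r₂ ^ 2)⁻¹
    refine hg2.congr fun e ↦ ?_
    push_cast
    field_simp
    ring
  refine ⟨∑' e : ℕ, ((e : ℝ) + 2) ^ d * r₂ ^ e, tsum_nonneg fun e ↦ by positivity, fun p hp ↦ ?_⟩
  have hp2 : (2 : ℝ) ≤ p := by exact_mod_cast hp.two_le
  have hp0 : (0 : ℝ) < p := by linarith
  set r : ℝ := (p : ℝ) ^ (-σ) with hr
  have hr0 : 0 < r := Real.rpow_pos_of_pos hp0 _
  have hrr₂ : r ≤ r₂ := Real.rpow_le_rpow_of_nonpos two_pos hp2 (by linarith)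
  have hs := summable_localFactor_rpow (K := K) hσ hp
  rw [hs.tsum_eq_zero_add]
  have h0 : (idealNormCount K (p ^ 0) : ℝ) * ((p : ℝ) ^ 0) ^ (-σ) = 1 := by
    simp [idealNormCount_one]
  rw [h0]
  gcongr
  -- `∑_e c_K(p^{e+1}) (p^{e+1})^{-σ} ≤ M r`
  have hpow : ∀ e : ℕ, ((p : ℝ) ^ e) ^ (-σ) = r ^ e := fun e ↦ by
    rw [hr, ← Real.rpow_natCast, ← Real.rpow_mul hp0.le, mul_comm, Real.rpow_mul hp0.le,
      Real.rpow_natCast]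
  have hle : ∀ e : ℕ, (idealNormCount K (p ^ (e + 1)) : ℝ) * ((p : ℝ) ^ (e + 1)) ^ (-σ) ≤
      ((e : ℝ) + 2) ^ d * r₂ ^ e * r := fun e ↦ by
    rw [hpow, pow_succ]
    have hce := idealNormCount_prime_pow_le K p (e + 1) hp
    push_cast at hce
    calc (idealNormCount K (p ^ (e + 1)) : ℝ) * (r ^ e * r) ≤ ((e : ℝ) + 1 + 1) ^ d * (r₂ ^ e * r) := by
          gcongr
      _ = ((e : ℝ) + 2) ^ d * r₂ ^ e * r := by ring
  calc ∑' e : ℕ, (idealNormCount K (p ^ (e + 1)) : ℝ) * ((p : ℝ) ^ (e + 1)) ^ (-σ)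
      ≤ ∑' e : ℕ, ((e : ℝ) + 2) ^ d * r₂ ^ e * r :=
        Summable.tsum_le_tsum hle ((summable_nat_add_iff 1).2 hs) (hM.mul_right r)
    _ = (∑' e : ℕ, ((e : ℝ) + 2) ^ d * r₂ ^ e) * r := tsum_mul_right

open scoped Classical in
/-- **`∑_n h_𝔠(n) n^{-σ} ≤ ∏_{p ∣ N(𝔠)} ∑_e c_K(p^e)(p^e)^{-σ}`** (`σ > 0`): `h_𝔠(n) ≤ c_K(n)` and `h_𝔠` is
supported on the numbers all of whose prime factors divide `N(𝔠)`, so the sum is majorised by the finite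
Euler product (Mathlib's `EulerProduct.summable_and_hasSum_factoredNumbers_prod_filter_prime_tsum`) of the
multiplicative function `c_K(n) n^{-σ}`; the case `σ = 1/2` is `tsum_norm_term_supportedCount_le`. [folklore] -/
theorem tsum_norm_term_supportedCount_rpow_le {σ : ℝ} (hσ : 0 < σ) {𝔠 : Ideal (𝓞 K)} (h𝔠 : 𝔠 ≠ ⊥) :
    (Summable fun n ↦ ‖term (fun n ↦ (Nat.card {D : Ideal (𝓞 K) //
        Ideal.absNorm D = n ∧ ∀ P ∈ normalizedFactors D, P ∣ 𝔠} : ℂ)) (σ : ℂ) n‖) ∧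
    ∑' n, ‖term (fun n ↦ (Nat.card {D : Ideal (𝓞 K) //
        Ideal.absNorm D = n ∧ ∀ P ∈ normalizedFactors D, P ∣ 𝔠} : ℂ)) (σ : ℂ) n‖ ≤
      ∏ p ∈ (Ideal.absNorm 𝔠).primeFactors,
        ∑' e : ℕ, (idealNormCount K (p ^ e) : ℝ) * ((p : ℝ) ^ e) ^ (-σ) := by
  classical
  set S : Finset ℕ := (Ideal.absNorm 𝔠).primeFactors with hS
  set f : ℕ → ℝ := fun m ↦ (idealNormCount K m : ℝ) * (m : ℝ) ^ (-σ) with hf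
  have hf1 : f 1 = 1 := by simp [hf, idealNormCount_one]
  have hmul : ∀ {m n : ℕ}, Nat.Coprime m n → f (m * n) = f m * f n := by
    intro m n hmn
    simp only [hf]
    rw [idealNormCount_mul_of_coprime K hmn, Nat.cast_mul, Nat.cast_mul,
      Real.mul_rpow (Nat.cast_nonneg _) (Nat.cast_nonneg _)]
    ring
  have hloc : ∀ {p : ℕ}, p.Prime → Summable fun e : ℕ ↦ ‖f (p ^ e)‖ := by
    intro p hp
    refine (summable_localFactor_rpow (K := K) hσ hp).congr fun e ↦ ?_
    rw [hf, Real.norm_of_nonneg (by positivity)]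
    push_cast
    rfl
  obtain ⟨-, hsum⟩ :=
    EulerProduct.summable_and_hasSum_factoredNumbers_prod_filter_prime_tsum hf1 hmul hloc S
  have hfilter : S.filter Nat.Prime = S :=
    Finset.filter_true_of_mem fun p hp ↦ Nat.prime_of_mem_primeFactors hp
  rw [hfilter] at hsum
  have hind : HasSum ((Nat.factoredNumbers S).indicator f) (∏ p ∈ S, ∑' e : ℕ, f (p ^ e)) :=
    hasSum_subtype_iff_indicator.1 hsum
  have hle : ∀ n, ‖term (fun n ↦ (Nat.card {D : Ideal (𝓞 K) //
      Ideal.absNorm D = n ∧ ∀ P ∈ normalizedFactors D, P ∣ 𝔠} : ℂ)) (σ : ℂ) n‖ ≤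
      (Nat.factoredNumbers S).indicator f n := by
    intro n
    rcases eq_or_ne n 0 with rfl | hn
    · rw [term_zero, norm_zero]
      exact Set.indicator_nonneg (fun m _ ↦ by simp only [hf]; positivity) _
    rw [norm_term_eq, if_neg hn, Complex.norm_natCast]
    simp only [Complex.ofReal_re]
    by_cases hmem : n ∈ Nat.factoredNumbers S
    · rw [Set.indicator_of_mem hmem, hf]
      simp only
      rw [Real.rpow_neg (Nat.cast_nonneg n), ← div_eq_mul_inv]
      gcongr
      exact_mod_cast card_supported_le 𝔠 n
    · rw [Set.indicator_of_notMem hmem]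
      have h0 : Nat.card {D : Ideal (𝓞 K) //
          Ideal.absNorm D = n ∧ ∀ P ∈ normalizedFactors D, P ∣ 𝔠} = 0 := by
        rw [Nat.card_eq_zero]
        left
        refine ⟨fun ⟨D, hD, hsupp⟩ ↦ ?_⟩
        have hD0 : D ≠ ⊥ := by rw [Ne, ← Ideal.absNorm_eq_zero_iff, hD]; exact hn
        exact hmem (hD ▸ absNorm_mem_factoredNumbers h𝔠 hD0 hsupp)
      rw [h0]
      simp
  have hsumm : Summable fun n ↦ ‖term (fun n ↦ (Nat.card {D : Ideal (𝓞 K) //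
      Ideal.absNorm D = n ∧ ∀ P ∈ normalizedFactors D, P ∣ 𝔠} : ℂ)) (σ : ℂ) n‖ :=
    Summable.of_nonneg_of_le (fun n ↦ norm_nonneg _) hle hind.summable
  refine ⟨hsumm, ?_⟩
  calc _ ≤ ∑' n, (Nat.factoredNumbers S).indicator f n :=
        Summable.tsum_le_tsum hle hsumm hind.summable
    _ = ∏ p ∈ S, ∑' e : ℕ, f (p ^ e) := hind.tsum_eq
    _ = _ := by
        refine Finset.prod_congr rfl fun p _ ↦ tsum_congr fun e ↦ ?_
        simp only [hf]
        push_cast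
        rfl

/-- The Euler-product factor is at most `exp(M ∑_{p ∣ N(𝔠)} p^{-σ})` (`1 + u ≤ e^u`). [folklore] -/
theorem prod_localFactor_rpow_le_exp {σ M : ℝ}
    (hM : ∀ p : ℕ, p.Prime →
      ∑' e : ℕ, (idealNormCount K (p ^ e) : ℝ) * ((p : ℝ) ^ e) ^ (-σ) ≤ 1 + M * (p : ℝ) ^ (-σ))
    (𝔠 : Ideal (𝓞 K)) :
    ∏ p ∈ (Ideal.absNorm 𝔠).primeFactors, ∑' e : ℕ, (idealNormCount K (p ^ e) : ℝ) * ((p : ℝ) ^ e) ^ (-σ) ≤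
      Real.exp (M * ∑ p ∈ (Ideal.absNorm 𝔠).primeFactors, (p : ℝ) ^ (-σ)) := by
  rw [Finset.mul_sum, Real.exp_sum]
  refine Finset.prod_le_prod (fun p _ ↦ tsum_nonneg fun e ↦ by positivity) fun p hp ↦ ?_
  have hp := Nat.prime_of_mem_primeFactors hp
  calc ∑' e : ℕ, (idealNormCount K (p ^ e) : ℝ) * ((p : ℝ) ^ e) ^ (-σ) ≤ 1 + M * (p : ℝ) ^ (-σ) := hM p hp
    _ = M * (p : ℝ) ^ (-σ) + 1 := add_comm _ _
    _ ≤ Real.exp (M * (p : ℝ) ^ (-σ)) := Real.add_one_le_exp _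

open scoped Classical in
/-- **Möbius sums over the ideals coprime to `𝔠`, numerator bounded on `Re s = σ ∈ (0, 1)`**
(Heath-Brown p. 51: "`f(s+1) = ζ_K(s+1)^{-1}∏_{P∣C}(1 − N(P)^{-s-1})^{-1}` … `∏_{P∣C}(…) ≪ exp{c(log N(C))^{1/4}}`
… we may therefore change the path of integration in the usual way to obtain
`Σ = res{f(s+1)x^s s^{-2} : s = 0} + O(exp{−c√(log x)})` … whenever `N(C) ≤ x`"): for `0 < σ < 1`
there are `c > 0`, `C > 0`, `M ≥ 0` (depending on `K`, `σ`) such that for every nonzero ideal `𝔠` and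
every `x ≥ 1`,
`|∑_{n ≤ x} a_𝔠(n) n^{-1} log(x/n) − ρ_K^{-1}∏_{P ∣ 𝔠}(1 − N(P)^{-1})^{-1}| ≤ C·exp(M ∑_{p ∣ N(𝔠)} p^{-σ})·exp(−c√(log x))`,
`a_𝔠(n) = ∑_{N(B)=n, B+𝔠=(1)} μ(B)`. From `logRieszMean_LSeries_div_dedekindZeta_bound` (`σ_h = σ`) with
`tsum_norm_term_supportedCount_rpow_le`, `exists_localFactor_rpow_le`, `prod_localFactor_rpow_le_exp`.
[cite: HeathBrownActa2001, §8 p. 51] -/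
theorem coprimeMoebius_logRieszMean_bound_rpow {σ : ℝ} (hσ0 : 0 < σ) (hσ1 : σ < 1) :
    ∃ c : ℝ, 0 < c ∧ ∃ C : ℝ, 0 < C ∧ ∃ M : ℝ, 0 ≤ M ∧ ∀ 𝔠 : Ideal (𝓞 K), 𝔠 ≠ ⊥ → ∀ x : ℝ, 1 ≤ x →
      ‖(∑ n ∈ Finset.Icc 1 ⌊x⌋₊,
          ((∑ B ∈ (idealsOfNorm K n).filter (fun B ↦ B ⊔ 𝔠 = ⊤), idealMoebius B : ℤ) : ℂ) / n *
            (Real.log (x / n) : ℂ)) -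
          ((∏ P ∈ (normalizedFactors 𝔠).toFinset, (1 - (Ideal.absNorm P : ℝ)⁻¹)⁻¹ : ℝ) : ℂ) /
            (_root_.NumberField.dedekindZeta_residue K : ℂ)‖ ≤
        C * Real.exp (M * ∑ p ∈ (Ideal.absNorm 𝔠).primeFactors, (p : ℝ) ^ (-σ)) *
          Real.exp (-c * Real.sqrt (Real.log x)) := by
  obtain ⟨c, hc, C, hC, h⟩ := logRieszMean_LSeries_div_dedekindZeta_bound K (σₕ := σ) hσ1
  obtain ⟨M, hM0, hM⟩ := exists_localFactor_rpow_le (K := K) hσ0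
  refine ⟨c, hc, C, hC, M, hM0, fun 𝔠 h𝔠 x hx ↦ ?_⟩
  obtain ⟨hhs, hhB⟩ := tsum_norm_term_supportedCount_rpow_le (K := K) hσ0 h𝔠
  have hhs' : LSeriesSummable (fun n ↦ (Nat.card {D : Ideal (𝓞 K) //
      Ideal.absNorm D = n ∧ ∀ P ∈ normalizedFactors D, P ∣ 𝔠} : ℂ)) (σ : ℂ) :=
    hhs.of_norm
  have key := h (fun n ↦ ((∑ B ∈ (idealsOfNorm K n).filter (fun B ↦ B ⊔ 𝔠 = ⊤),
      idealMoebius B : ℤ) : ℂ))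
    (fun n ↦ (Nat.card {D : Ideal (𝓞 K) //
      Ideal.absNorm D = n ∧ ∀ P ∈ normalizedFactors D, P ∣ 𝔠} : ℂ)) _ hhs'
    (hhB.trans (prod_localFactor_rpow_le_exp hM 𝔠))
    (fun σ' hσ' ↦ LSeriesSummable_coprimeMoebiusSum 𝔠 (by simpa using hσ'))
    (fun s hs ↦ LSeries_coprimeMoebiusSum_mul_dedekindZeta h𝔠 hs) x hx
  rwa [LSeries_supportedCount_one h𝔠] at key

end Literature.NumberTheory.LFunctions.NumberField

end
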